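import Mathlib
import HarnessLib
import Literature.Analysis.Complex.VitaliConvergence
import Summits.Parity.BatemanHorn.Theses.AlmostPrimeZeros

/-!
# Route AlmostPrimeZeros — support item `VitaliDerivatives` (stmt-Parity-11329)

Pure complex analysis.  Let `Λ` be holomorphic on `|z| < 2`, `0 < η ≤ 1/4`, and let the family
`H_x(z) = x⁻¹ e^{k(1−z) log log x} Σ_{0 ≤ n ≤ x} z^{s_f(n)}` (entire in `z`) be locally bounded on the
thin rectangle `V_η = {−η < Re z < 7/4, |Im z| < η}` and converge for REAL `y ∈ (5/4, 7/4)` to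
`Ψ(y) = Λ(y) e^{(y−1) log D} (Γ(y)⁻¹)^k`.  Then `iteratedDeriv k H_x 0 → iteratedDeriv k Ψ 0`.

Proof.  `V_η` is open, convex (hence preconnected), contains `0` and the real segment
`(5/4, 7/4)`, and lies in the ball `|z| < 2` (`‖z‖ ≤ |Re z| + |Im z| < 7/4 + 1/4`), on which `Ψ`
is holomorphic (`1/Γ` is entire, `Complex.differentiable_one_div_Gamma`).  The segment
accumulates at its midpoint `3/2 ∈ V_η`, so Vitali–Porter
(`Literature.Analysis.Complex.exists_tendstoLocallyUniformlyOn_of_frequently_tendsto`, proved in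
the tree) gives a holomorphic locally uniform limit `g` of `H_x` on `V_η`; `g = Ψ` on the segment
(uniqueness of limits), hence on `V_η` (identity theorem); Weierstrass
(`TendstoLocallyUniformlyOn.deriv`, iterated) gives locally uniform convergence of the `k`-th
derivatives, evaluated at `0 ∈ V_η`, and `iteratedDeriv k g 0 = iteratedDeriv k Ψ 0` because
`g = Ψ` near `0`.

References: Vitali 1903 / Porter 1904; Titchmarsh, *The Theory of Functions* §5.21; Conway,
*Functions of One Complex Variable* VII §2.
-/

noncomputable section

namespace Summit.Parity.BatemanHorn.Theorems

open Filter Set Metric Topology Complex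

/-- Weierstrass: locally uniform convergence of holomorphic functions on an open set passes to
all iterated derivatives (Mathlib's `TendstoLocallyUniformlyOn.deriv`, iterated). -/
private theorem tendstoLocallyUniformlyOn_iteratedDeriv_of_differentiableOn {F : ℕ → ℂ → ℂ}
    {g : ℂ → ℂ} {U : Set ℂ} (hU : IsOpen U) (hF : ∀ n, DifferentiableOn ℂ (F n) U)
    (h : TendstoLocallyUniformlyOn F g atTop U) (k : ℕ) :
    TendstoLocallyUniformlyOn (fun n => iteratedDeriv k (F n)) (iteratedDeriv k g) atTop U := by
  induction k with
  | zero => simpa using h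
  | succ k ih =>
    have hd : ∀ᶠ n in atTop, DifferentiableOn ℂ (iteratedDeriv k (F n)) U :=
      Eventually.of_forall fun n => by
        rw [iteratedDeriv_eq_iterate]
        exact (((hF n).analyticOnNhd hU).iterated_deriv k).differentiableOn
    simpa [iteratedDeriv_succ, Function.comp_def] using ih.deriv hd hU

/-- **Vitali extraction of Taylor coefficients.**  A locally bounded sequence `F n` of holomorphic
functions on a connected open `U ∋ 0` containing a real interval `(a, b)`, `a < b`, which
converges pointwise on `(a, b)` to a function `Ψ` holomorphic on `U`, has
`iteratedDeriv k (F n) 0 → iteratedDeriv k Ψ 0` for every `k` (Vitali–Porter + identity theorem +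
Weierstrass). -/
private theorem tendsto_iteratedDeriv_of_vitali {F : ℕ → ℂ → ℂ} {Ψ : ℂ → ℂ} {U : Set ℂ}
    {a b : ℝ} (hUo : IsOpen U) (hUc : IsPreconnected U) (h0 : (0 : ℂ) ∈ U)
    (hF : ∀ n, DifferentiableOn ℂ (F n) U) (hΨ : DifferentiableOn ℂ Ψ U)
    (hb : ∀ z₀ ∈ U, ∃ M : ℝ, ∃ r > 0, ∀ n, ∀ z ∈ ball z₀ r ∩ U, ‖F n z‖ ≤ M) (hab : a < b)
    (hI : ∀ t ∈ Ioo a b, (t : ℂ) ∈ U)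
    (hconv : ∀ t ∈ Ioo a b, Tendsto (fun n => F n t) atTop (𝓝 (Ψ t))) (k : ℕ) :
    Tendsto (fun n => iteratedDeriv k (F n) 0) atTop (𝓝 (iteratedDeriv k Ψ 0)) := by
  -- the midpoint of the segment, a point of `U` at which the segment accumulates
  set t₀ : ℝ := (a + b) / 2 with ht₀
  have ht₀I : t₀ ∈ Ioo a b := ⟨by rw [ht₀]; linarith, by rw [ht₀]; linarith⟩
  have hz₀ : (t₀ : ℂ) ∈ U := hI t₀ ht₀I
  have htend : Tendsto (fun s : ℝ => (s : ℂ)) (𝓝[>] t₀) (𝓝[≠] (t₀ : ℂ)) := by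
    have h1 : Tendsto (fun s : ℝ => (s : ℂ)) (𝓝[>] t₀) (𝓝[{(t₀ : ℂ)}ᶜ] (t₀ : ℂ)) :=
      continuous_ofReal.continuousWithinAt.tendsto_nhdsWithin fun s hs =>
        fun h => (ne_of_gt hs) (ofReal_injective h)
    simpa using h1
  have hevI : ∀ᶠ s : ℝ in 𝓝[>] t₀, s ∈ Ioo a b :=
    mem_nhdsWithin_of_mem_nhds (isOpen_Ioo.mem_nhds ht₀I)
  -- Vitali–Porter: a holomorphic locally uniform limit `g` on `U`
  have hS : ∃ᶠ z in 𝓝[≠] (t₀ : ℂ), ∃ c : ℂ, Tendsto (fun n => F n z) atTop (𝓝 c) :=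
    htend.frequently (hevI.mono fun s hs => ⟨Ψ s, hconv s hs⟩).frequently
  obtain ⟨g, hg, hlim⟩ :=
    Literature.Analysis.Complex.exists_tendstoLocallyUniformlyOn_of_frequently_tendsto hUo hUc hF
      hb hz₀ hS
  -- identification of the limit: `g = Ψ` on the segment, hence on `U`
  have hfreq : ∃ᶠ z in 𝓝[≠] (t₀ : ℂ), g z = Ψ z := by
    refine htend.frequently (hevI.mono fun s hs => ?_).frequently
    exact tendsto_nhds_unique (hlim.tendsto_at (hI s hs)) (hconv s hs)
  have heq : EqOn g Ψ U :=
    (hg.analyticOnNhd hUo).eqOn_of_preconnected_of_frequently_eq (hΨ.analyticOnNhd hUo) hUc hz₀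
      hfreq
  -- Weierstrass at `0 ∈ U`
  have h1 : Tendsto (fun n => iteratedDeriv k (F n) 0) atTop (𝓝 (iteratedDeriv k g 0)) :=
    (tendstoLocallyUniformlyOn_iteratedDeriv_of_differentiableOn hUo hF hlim k).tendsto_at h0
  have h2 : iteratedDeriv k g 0 = iteratedDeriv k Ψ 0 :=
    (eventuallyEq_of_mem (hUo.mem_nhds h0) heq).iteratedDeriv_eq k
  rwa [h2] at h1

/-- **Item `VitaliDerivatives` (stmt-Parity-11329) of route AlmostPrimeZeros, proved.**  If `Λ` is
holomorphic on `|z| < 2`, `0 < η ≤ 1/4`, the family `H_x` is locally bounded on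
`V_η = {−η < Re z < 7/4, |Im z| < η}` (ball form) and `H_x(y) → Ψ(y) = Λ(y) e^{(y−1) log D} (Γ(y)⁻¹)^k`
for real `y ∈ (5/4, 7/4)`, then `iteratedDeriv k H_x 0 → iteratedDeriv k Ψ 0`
(Vitali–Porter on the convex open `V_η ⊆ {|z| < 2}`, identity theorem, Weierstrass). -/
theorem vitaliDerivatives_proof :
    Summit.Parity.BatemanHorn.Theses.AlmostPrimeZeros.VitaliDerivatives := by
  intro k f Λ η hη hη4 hΛ hB hconv
  -- geometry of the rectangle `V_η`
  have hUeq : {z : ℂ | -η < z.re ∧ z.re < 7 / 4 ∧ |z.im| < η} =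
      {z : ℂ | -η < z.re} ∩ ({z : ℂ | z.re < 7 / 4} ∩ ({z : ℂ | -η < z.im} ∩ {z : ℂ | z.im < η})) := by
    ext z
    simp only [mem_setOf_eq, mem_inter_iff, abs_lt]
  have hUo : IsOpen {z : ℂ | -η < z.re ∧ z.re < 7 / 4 ∧ |z.im| < η} := by
    rw [hUeq]
    exact (isOpen_lt continuous_const continuous_re).inter
      ((isOpen_lt continuous_re continuous_const).inter
        ((isOpen_lt continuous_const continuous_im).inter (isOpen_lt continuous_im continuous_const)))
  have hUc : IsPreconnected {z : ℂ | -η < z.re ∧ z.re < 7 / 4 ∧ |z.im| < η} := by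
    rw [hUeq]
    exact ((convex_halfSpace_re_gt _).inter ((convex_halfSpace_re_lt _).inter
      ((convex_halfSpace_im_gt _).inter (convex_halfSpace_im_lt _)))).isPreconnected
  have h0 : (0 : ℂ) ∈ {z : ℂ | -η < z.re ∧ z.re < 7 / 4 ∧ |z.im| < η} := by
    simp only [mem_setOf_eq, zero_re, zero_im, abs_zero]
    exact ⟨by linarith, by norm_num, hη⟩
  have hsub : {z : ℂ | -η < z.re ∧ z.re < 7 / 4 ∧ |z.im| < η} ⊆ Metric.ball (0 : ℂ) 2 := by
    rintro z ⟨h1, h2, h3⟩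
    rw [Metric.mem_ball, dist_zero_right]
    have hre : |z.re| < 7 / 4 := abs_lt.2 ⟨by linarith, h2⟩
    have him : |z.im| < 1 / 4 := lt_of_lt_of_le h3 hη4
    have := norm_le_abs_re_add_abs_im z
    linarith
  have hI : ∀ t ∈ Ioo (5 / 4 : ℝ) (7 / 4), (t : ℂ) ∈ {z : ℂ | -η < z.re ∧ z.re < 7 / 4 ∧ |z.im| < η} := by
    rintro t ⟨ht1, ht2⟩
    simp only [mem_setOf_eq, ofReal_re, ofReal_im, abs_zero]
    exact ⟨by linarith, ht2, hη⟩
  -- holomorphy of the family and of the limit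
  have hF : ∀ x : ℕ, DifferentiableOn ℂ (fun z : ℂ => (x : ℂ)⁻¹ *
      Complex.exp ((k : ℂ) * (1 - z) * (Real.log (Real.log x) : ℂ)) *
        ∑ n ∈ Finset.range (x + 1),
          z ^ (∑ i, (((f i).eval (n : ℤ)).toNat.factorization.sum fun _ v => min v 2)))
      {z : ℂ | -η < z.re ∧ z.re < 7 / 4 ∧ |z.im| < η} := fun x =>
    Differentiable.differentiableOn (by fun_prop)
  have hΨ : DifferentiableOn ℂ (fun z : ℂ => Λ z *
      Complex.exp ((z - 1) * (Real.log (∏ i, ((f i).natDegree : ℝ)) : ℂ)) * (Complex.Gamma z)⁻¹ ^ k)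
      {z : ℂ | -η < z.re ∧ z.re < 7 / 4 ∧ |z.im| < η} := by
    refine (((hΛ.mono hsub).mul (Differentiable.differentiableOn ?_)).mul
      (Differentiable.differentiableOn ?_))
    · fun_prop
    · exact Complex.differentiable_one_div_Gamma.pow k
  -- Vitali
  exact tendsto_iteratedDeriv_of_vitali hUo hUc h0 hF hΨ hB (by norm_num) hI
    (fun t ht => hconv t ht.1 ht.2) k

end Summit.Parity.BatemanHorn.Theorems
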